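import Literature.Topology.FourManifolds.CappedBallLid
import Literature.Topology.FourManifolds.SchoenfliesTools
import HarnessLib

/-!
# Sweep functions with a standard face (Schultens' Schönflies proof, the induction invariant)

Topic `Literature/Topology/FourManifolds`.  The Morse-theoretic proof of the smooth Schönflies
theorem (Schultens, *Introduction to 3-Manifolds* (2014), Thm. 3.2.5, PDF pp. 43–45) cuts a
sphere along an innermost level circle, caps the two halves by discs ("lids"), applies the
induction hypothesis to the half with fewer saddles and glues back (Lemma 3.2.3: a ball attached
to a ball along a disc).  In the region language of this development the gluing is performed by
the sweep lemma (`SweepLemma.lean`, `SweepTransfer.lean`), and the induction hypothesis is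
strengthened accordingly: a solid `A = {F ≤ 0}` carrying the standard lid of scale `s`
(`CappedBallLid.lean`) around the vertical axis is **sweepable from its face** if there is a smooth
function `w` which

* is the explicit **standard sweep function** `w_std = 1 + (x₂ - z_b(ρ²))/κ` on the face box
  `G_s = {ρ² < (1+3s/2)², -2s < x₂ < 5s/4}`, where `z_b(ρ²) = s/2 - λ + λ ρ²` is a shallow bowl
  (`0 < λ ≤ s/8`), so that `{w ≥ 1} ∩ G_s` is the region above the bowl;
* is `< 1` on `A` off the face box (the whole body of `A` is swept);
* has no critical points on `A ∩ {w ≤ 1 + 3δ₀}`;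
* at the boundary points of `A` off the face box with `w ≤ 1 + 3δ₀`, has a derivative which is
  not a nonnegative multiple of the outward conormal `DF`.

This file fixes these definitions (`faceBox`, `bowl`, `wstd`, `SweepFn`, `Sweepable`) and proves
the interface lemmas: the derivative of `w_std`, monotonicity in `δ₀`, and the **transport
lemma** `SweepFn.transport` — a sweep function for `Φ(A)` pulls back along a diffeomorphism `Φ`
fixing the face box to a sweep function for `A`.

## References
* J. Schultens, *Introduction to 3-Manifolds*, GSM 151, AMS (2014), Thm. 3.2.5, Lemma 3.2.3.
-/

noncomputable section

open Set Metric Filter Topology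
open scoped Manifold ContDiff

namespace Literature.Topology.FourManifolds.SweepFace

open CappedBallLid

/-- The open **face box** `G_s = {ρ² < (1+3s/2)², -2s < x₂ < 5s/4}` around the standard lid of
scale `s` (its closure lies in the lid zone `{ρ² < (1+2s)², -5s/2 < x₂ < 3s/2}` of
`CappedBallLid.lean`). [cite: Schultens2014, proof of Thm. 3.2.5 (PDF p. 45)] -/
def faceBox (s : ℝ) : Set (EuclideanSpace ℝ (Fin 3)) :=
  {x | hsq x < (1 + 3 * s / 2) ^ 2 ∧ -(2 * s) < x 2 ∧ x 2 < 5 * s / 4}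

/-- The **cutting bowl** `z_b(x) = s/2 - λ + λ ρ²`: height `s/2 - λ` on the axis, `s/2` over the
unit circle. [cite: Schultens2014, Lemma 3.2.3 (PDF p. 43)] -/
def bowl (s lam : ℝ) (x : EuclideanSpace ℝ (Fin 3)) : ℝ := s / 2 - lam + lam * hsq x

/-- The **standard sweep function** `w_std = 1 + (x₂ - z_b)/κ`: its level sets in the face box
are the vertical translates of the bowl. [cite: Schultens2014, Lemma 3.2.3 (PDF p. 43)] -/
def wstd (s lam κ : ℝ) (x : EuclideanSpace ℝ (Fin 3)) : ℝ := 1 + (x 2 - bowl s lam x) / κ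

/-- **Sweep function with standard face.**  `w` sweeps the solid `{F ≤ 0}` from its standard
face of scale `s`: standard on the face box, `< 1` on the solid off the box, no critical points
on the solid where `w ≤ 1 + 3δ₀`, and never a nonnegative multiple of the conormal at boundary
points off the box where `w ≤ 1 + 3δ₀`. [cite: Schultens2014, proof of Thm. 3.2.5 (PDF p. 45)] -/
structure SweepFn (F : EuclideanSpace ℝ (Fin 3) → ℝ) (s lam κ δ₀ : ℝ)
    (w : EuclideanSpace ℝ (Fin 3) → ℝ) : Prop where
  smooth : ContDiff ℝ ∞ w
  std : ∀ x ∈ faceBox s, w x = wstd s lam κ x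
  lt_one : ∀ x, F x ≤ 0 → x ∉ faceBox s → w x < 1
  fderiv_ne : ∀ x, F x ≤ 0 → w x ≤ 1 + 3 * δ₀ → fderiv ℝ w x ≠ 0
  conormal : ∀ x, F x = 0 → x ∉ faceBox s → w x ≤ 1 + 3 * δ₀ → ∀ c : ℝ, 0 ≤ c →
    fderiv ℝ w x ≠ c • fderiv ℝ F x

/-- **Sweepable from the standard face of scale `s`.**
[cite: Schultens2014, proof of Thm. 3.2.5 (PDF p. 45)] -/
def Sweepable (F : EuclideanSpace ℝ (Fin 3) → ℝ) (s : ℝ) : Prop :=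
  ∃ lam κ δ₀ : ℝ, ∃ w : EuclideanSpace ℝ (Fin 3) → ℝ,
    0 < lam ∧ lam ≤ s / 8 ∧ 0 < κ ∧ 0 < δ₀ ∧ SweepFn F s lam κ δ₀ w

/-! ### §1 The face box and the standard sweep function -/

/-- The face box is open. [folklore] -/
theorem isOpen_faceBox (s : ℝ) : IsOpen (faceBox s) := by
  have h2 : Continuous fun x : EuclideanSpace ℝ (Fin 3) => x 2 := by fun_prop
  have : faceBox s = {x | hsq x < (1 + 3 * s / 2) ^ 2} ∩ {x | -(2 * s) < x 2} ∩ {x | x 2 < 5 * s / 4} := by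
    ext x; simp [faceBox, and_assoc]
  rw [this]
  exact ((isOpen_lt (contDiff_hsq (n := ∞)).continuous continuous_const).inter
    (isOpen_lt continuous_const h2)).inter (isOpen_lt h2 continuous_const)

/-- The coordinate functional `x ↦ x₂`. [folklore] -/
def dz : EuclideanSpace ℝ (Fin 3) →L[ℝ] ℝ := EuclideanSpace.proj (2 : Fin 3)

/-- `dz v = v₂`. [folklore] -/
@[simp] theorem dz_apply (v : EuclideanSpace ℝ (Fin 3)) : dz v = v 2 := rfl

/-- `x ↦ x₂` has derivative `dz`. [folklore] -/
theorem hasFDerivAt_coord_two (x : EuclideanSpace ℝ (Fin 3)) :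
    HasFDerivAt (fun y : EuclideanSpace ℝ (Fin 3) => y 2) dz x :=
  (dz : EuclideanSpace ℝ (Fin 3) →L[ℝ] ℝ).hasFDerivAt

/-- The bowl is smooth. [folklore] -/
theorem contDiff_bowl (s lam : ℝ) {n : WithTop ℕ∞} : ContDiff ℝ n (bowl s lam) :=
  contDiff_const.add (contDiff_const.mul contDiff_hsq)

/-- The standard sweep function is smooth. [folklore] -/
theorem contDiff_wstd (s lam κ : ℝ) {n : WithTop ℕ∞} : ContDiff ℝ n (wstd s lam κ) := by
  have h2 : ContDiff ℝ n fun x : EuclideanSpace ℝ (Fin 3) => x 2 := by fun_prop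
  exact contDiff_const.add ((h2.sub (contDiff_bowl s lam)).div_const κ)

/-- **Derivative of the standard sweep function**: `Dw_std = κ⁻¹ (dx₂ - λ dρ²)`. [folklore] -/
theorem hasFDerivAt_wstd (s lam κ : ℝ) (x : EuclideanSpace ℝ (Fin 3)) :
    HasFDerivAt (wstd s lam κ) (κ⁻¹ • (dz - lam • dhsq x)) x := by
  have hb : HasFDerivAt (bowl s lam) (lam • dhsq x) x := by
    have := ((hasFDerivAt_hsq x).const_smul lam).const_add (s / 2 - lam)
    refine this.congr_of_eventuallyEq (Filter.Eventually.of_forall fun y => ?_)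
    simp [bowl, smul_eq_mul]
  have h := (((hasFDerivAt_coord_two x).sub hb).mul_const κ⁻¹).const_add 1
  refine h.congr_of_eventuallyEq (Filter.Eventually.of_forall fun y => ?_)
  simp [wstd, div_eq_mul_inv]

/-- `Dw_std(x) = κ⁻¹ (dx₂ - λ dρ²(x))`. [folklore] -/
theorem fderiv_wstd (s lam κ : ℝ) (x : EuclideanSpace ℝ (Fin 3)) :
    fderiv ℝ (wstd s lam κ) x = κ⁻¹ • (dz - lam • dhsq x) :=
  (hasFDerivAt_wstd s lam κ x).fderiv

/-- The vertical component of `Dw_std` is `κ⁻¹`. [folklore] -/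
theorem fderiv_wstd_apply_e2 (s lam κ : ℝ) (x : EuclideanSpace ℝ (Fin 3)) :
    fderiv ℝ (wstd s lam κ) x (EuclideanSpace.single 2 1) = κ⁻¹ := by
  rw [fderiv_wstd]
  simp [dhsq]

/-- `Dw_std ≠ 0` (for `κ ≠ 0`). [folklore] -/
theorem fderiv_wstd_ne_zero (s lam : ℝ) {κ : ℝ} (hκ : κ ≠ 0) (x : EuclideanSpace ℝ (Fin 3)) :
    fderiv ℝ (wstd s lam κ) x ≠ 0 := by
  intro h
  have := fderiv_wstd_apply_e2 s lam κ x
  rw [h] at this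
  exact hκ (inv_eq_zero.1 (by simpa using this.symm))

/-! ### §2 Interface lemmas -/

/-- Shrinking `δ₀` preserves a sweep function. [folklore] -/
theorem SweepFn.mono {F : EuclideanSpace ℝ (Fin 3) → ℝ} {s lam κ δ₀ δ₀' : ℝ}
    {w : EuclideanSpace ℝ (Fin 3) → ℝ} (h : SweepFn F s lam κ δ₀ w) (hle : δ₀' ≤ δ₀) :
    SweepFn F s lam κ δ₀' w where
  smooth := h.smooth
  std := h.std
  lt_one := h.lt_one
  fderiv_ne x hF hw := h.fderiv_ne x hF (by linarith)
  conormal x hF hx hw := h.conormal x hF hx (by linarith)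

/-- A diffeomorphism which is the identity on the face box maps no point from outside the box
into it. [folklore] -/
theorem not_mem_faceBox_of_apply {s : ℝ}
    (Φ : EuclideanSpace ℝ (Fin 3) ≃ₘ⟮𝓘(ℝ, EuclideanSpace ℝ (Fin 3)), 𝓘(ℝ, EuclideanSpace ℝ (Fin 3))⟯
      EuclideanSpace ℝ (Fin 3))
    (hid : ∀ x ∈ faceBox s, Φ x = x) {x : EuclideanSpace ℝ (Fin 3)} (hx : x ∉ faceBox s) :
    Φ x ∉ faceBox s := by
  intro hΦ
  have h1 : Φ (Φ x) = Φ x := hid _ hΦ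
  have h2 : Φ x = x := Φ.injective h1
  rw [h2] at hΦ
  exact hx hΦ

/-- **Transport of sweep functions.**  If `Φ` is a diffeomorphism with `Φ({F ≤ 0}) = {F_U ≤ 0}`
and `Φ({F = 0}) = {F_U = 0}`, equal to the identity on the face box, and both `F`, `F_U` have
regular zero sets, then a sweep function `w_U` for `F_U` pulls back to the sweep function
`w_U ∘ Φ` for `F` (same scale and constants).  Conormals transform covariantly: `F_U ∘ Φ` and `F`
cut out the same solid, so their differentials on the boundary are positively proportional
(`SchoenfliesTools.exists_pos_fderiv_eq_smul_of_eventually_iff`).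
[cite: Schultens2014, proof of Thm. 3.2.5 (PDF p. 45)] -/
theorem SweepFn.transport {F FU : EuclideanSpace ℝ (Fin 3) → ℝ} {s lam κ δ₀ : ℝ}
    {wU : EuclideanSpace ℝ (Fin 3) → ℝ} (hU : SweepFn FU s lam κ δ₀ wU)
    (Φ : EuclideanSpace ℝ (Fin 3) ≃ₘ⟮𝓘(ℝ, EuclideanSpace ℝ (Fin 3)), 𝓘(ℝ, EuclideanSpace ℝ (Fin 3))⟯
      EuclideanSpace ℝ (Fin 3))
    (hF : Differentiable ℝ F) (hFU : Differentiable ℝ FU)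
    (hregF : ∀ x, F x = 0 → fderiv ℝ F x ≠ 0) (hregU : ∀ y, FU y = 0 → fderiv ℝ FU y ≠ 0)
    (himg : Φ '' {x | F x ≤ 0} = {y | FU y ≤ 0}) (himg0 : Φ '' {x | F x = 0} = {y | FU y = 0})
    (hid : ∀ x ∈ faceBox s, Φ x = x) :
    SweepFn F s lam κ δ₀ (wU ∘ Φ) := by
  have hΦs : ContDiff ℝ ∞ Φ := Φ.contMDiff.contDiff
  have hΦis : ContDiff ℝ ∞ Φ.symm := Φ.symm.contMDiff.contDiff
  have hΦd : Differentiable ℝ Φ := hΦs.differentiable (by simp)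
  have hΦid : Differentiable ℝ Φ.symm := hΦis.differentiable (by simp)
  -- membership transfer
  have hmemU : ∀ x, F x ≤ 0 → FU (Φ x) ≤ 0 := fun x hx => by
    have : Φ x ∈ Φ '' {x | F x ≤ 0} := mem_image_of_mem _ hx
    rw [himg] at this; exact this
  have hmemU0 : ∀ x, F x = 0 → FU (Φ x) = 0 := fun x hx => by
    have : Φ x ∈ Φ '' {x | F x = 0} := mem_image_of_mem _ hx
    rw [himg0] at this; exact this
  -- `{F_U ∘ Φ ≤ 0} = {F ≤ 0}`
  have hiff : ∀ x, F x ≤ 0 ↔ FU (Φ x) ≤ 0 := by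
    intro x
    refine ⟨hmemU x, fun h => ?_⟩
    have : Φ x ∈ Φ '' {x | F x ≤ 0} := by rw [himg]; exact h
    obtain ⟨x', hx', he⟩ := this
    rw [← Φ.injective he]; exact hx'
  -- derivative of a composite with `Φ` vanishes only if the outer derivative does
  have hcomp : ∀ (g : EuclideanSpace ℝ (Fin 3) → ℝ) (x : EuclideanSpace ℝ (Fin 3)),
      DifferentiableAt ℝ g (Φ x) →
      fderiv ℝ g (Φ x) = (fderiv ℝ (g ∘ Φ) x).comp (fderiv ℝ Φ.symm (Φ x)) := by
    intro g x hg
    have h1 : g = (g ∘ Φ) ∘ Φ.symm := by ext y; simp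
    conv_lhs => rw [h1]
    rw [fderiv_comp _ (by rw [Φ.symm_apply_apply]; exact hg.comp x (hΦd x)) (hΦid _),
      Φ.symm_apply_apply]
  refine ⟨hU.smooth.comp hΦs, fun x hx => by simp [Function.comp, hid x hx, hU.std x hx],
    fun x hF' hx => hU.lt_one (Φ x) (hmemU x hF') (not_mem_faceBox_of_apply Φ hid hx), ?_, ?_⟩
  · -- no critical points
    intro x hF' hw h0
    have hwU : DifferentiableAt ℝ wU (Φ x) := hU.smooth.differentiable (by simp) _
    apply hU.fderiv_ne (Φ x) (hmemU x hF') hw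
    rw [hcomp wU x hwU, h0, ContinuousLinearMap.zero_comp]
  · -- conormals
    intro x hF0 hx hw c hc heq
    set y := Φ x with hy
    have hy0 : FU y = 0 := hmemU0 x hF0
    have hyb : y ∉ faceBox s := not_mem_faceBox_of_apply Φ hid hx
    have hwU : DifferentiableAt ℝ wU y := hU.smooth.differentiable (by simp) _
    have hFUy : DifferentiableAt ℝ FU y := hFU y
    -- `D(F_U ∘ Φ)(x) = μ DF(x)` with `μ > 0`
    have hG₂d : Differentiable ℝ (FU ∘ Φ) := hFU.comp hΦd
    have hDG₂ : fderiv ℝ (FU ∘ Φ) x ≠ 0 := by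
      intro h0
      apply hregU y hy0
      rw [hcomp FU x hFUy, h0, ContinuousLinearMap.zero_comp]
    obtain ⟨μ, hμ, hprop⟩ :=
      SchoenfliesTools.exists_pos_fderiv_eq_smul_of_eventually_iff hF hG₂d hF0
        (show (FU ∘ Φ) x = 0 from hy0) (hregF x hF0) hDG₂
        (Filter.Eventually.of_forall fun z => hiff z)
    -- transport the relation to `y`
    have hrel : fderiv ℝ wU y = (c / μ) • fderiv ℝ FU y := by
      rw [hcomp wU x hwU, hcomp FU x hFUy]
      rw [heq, hprop, ContinuousLinearMap.smul_comp, ContinuousLinearMap.smul_comp, smul_smul,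
        div_mul_cancel₀ _ hμ.ne']
    exact hU.conormal y hy0 hyb hw (c / μ) (div_nonneg hc hμ.le) hrel

/-! ### §3 The conormal test for the standard sweep function -/

/-- The horizontal position vector `x_h = (x₀, x₁, 0)`. [folklore] -/
def horiz (x : EuclideanSpace ℝ (Fin 3)) : EuclideanSpace ℝ (Fin 3) :=
  EuclideanSpace.single 0 (x 0) + EuclideanSpace.single 1 (x 1)

/-- `dx₂(x_h) = 0`. [folklore] -/
theorem dz_horiz (x : EuclideanSpace ℝ (Fin 3)) : dz (horiz x) = 0 := by
  simp [horiz]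

/-- `dρ²(x)(x_h) = 2ρ²`. [folklore] -/
theorem dhsq_horiz (x : EuclideanSpace ℝ (Fin 3)) : dhsq x (horiz x) = 2 * hsq x := by
  rw [dhsq_apply]
  simp [horiz, hsq]
  ring

/-- `dx₂(e₂) = 1`. [folklore] -/
theorem dz_e2 : dz (EuclideanSpace.single (2 : Fin 3) (1 : ℝ)) = 1 := by simp

/-- `dρ²(x)(e₂) = 0`. [folklore] -/
theorem dhsq_e2 (x : EuclideanSpace ℝ (Fin 3)) : dhsq x (EuclideanSpace.single (2 : Fin 3) 1) = 0 := by
  rw [dhsq_apply]; simp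

/-- **The conormal test.**  Off the axis, `Dw_std(x) = κ⁻¹(dx₂ - λ dρ²)` (`λ, κ > 0`) is never a
nonnegative multiple of a covector `A dx₂ + B dρ²(x)` with `B ≥ 0` — the outward conormals of the
wall, the fillet, the annulus, the corner and the rim of a lidded solid all have this form.
[cite: Schultens2014, Lemma 3.2.3 (PDF p. 43)] -/
theorem fderiv_wstd_ne_smul {s lam κ : ℝ} (hlam : 0 < lam) (hκ : 0 < κ)
    {x : EuclideanSpace ℝ (Fin 3)} (hx : hsq x ≠ 0) {A B : ℝ} (hB : 0 ≤ B) {c : ℝ} (hc : 0 ≤ c) :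
    fderiv ℝ (wstd s lam κ) x ≠ c • (A • dz + B • dhsq x) := by
  intro h
  rw [fderiv_wstd] at h
  have h1 := congrArg (fun L : EuclideanSpace ℝ (Fin 3) →L[ℝ] ℝ => L (EuclideanSpace.single 2 1)) h
  have h2 := congrArg (fun L : EuclideanSpace ℝ (Fin 3) →L[ℝ] ℝ => L (horiz x)) h
  rw [_root_.smul_apply, _root_.sub_apply, _root_.smul_apply, _root_.smul_apply, _root_.add_apply,
    _root_.smul_apply, _root_.smul_apply] at h1 h2
  rw [dz_e2, dhsq_e2] at h1
  rw [dz_horiz, dhsq_horiz] at h2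
  simp only [smul_eq_mul, mul_zero, sub_zero, mul_one, add_zero, zero_add] at h1 h2
  have hκ' : 0 < κ⁻¹ := inv_pos.2 hκ
  have hpos : 0 < hsq x := lt_of_le_of_ne (hsq_nonneg x) (Ne.symm hx)
  -- `h1 : κ⁻¹ = c * A`, `h2 : κ⁻¹ * -(lam * (2 ρ²)) = c * (B * (2 ρ²))`
  nlinarith [mul_nonneg hc hB, mul_pos hκ' hlam, mul_pos (mul_pos hκ' hlam) hpos,
    mul_nonneg (mul_nonneg hc hB) hpos.le]

/-- **Derivative of the swept defining function in the face box.**  If `DF₁(x) = A dx₂ + B dρ²(x)`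
then the combination `(1-θ) DF₁ - θ Dw_std` (the derivative of `F₁ ⊔ (1 - w_std)`) is again of
this form, with `ρ²`-coefficient `(1-θ)B + θλ/κ`. [folklore] -/
theorem combination_coeff {s lam κ θ A B : ℝ} (x : EuclideanSpace ℝ (Fin 3)) :
    (1 - θ) • (A • dz + B • dhsq x) + θ • (-(fderiv ℝ (wstd s lam κ) x)) =
      ((1 - θ) * A - θ * κ⁻¹) • dz + ((1 - θ) * B + θ * κ⁻¹ * lam) • dhsq x := by
  rw [fderiv_wstd]
  ext v
  simp only [_root_.add_apply, _root_.smul_apply, _root_.neg_apply, _root_.sub_apply, smul_eq_mul]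
  ring

/-- For `B ≥ 0`, `θ ∈ [0, 1]`, `λ, κ > 0` the coefficient `(1-θ)B + θλ/κ` vanishes only if
`θ = 0` and `B = 0`. [folklore] -/
theorem coeff_eq_zero_iff {lam κ θ B : ℝ} (hlam : 0 < lam) (hκ : 0 < κ) (hB : 0 ≤ B)
    (hθ0 : 0 ≤ θ) (hθ1 : θ ≤ 1) :
    (1 - θ) * B + θ * κ⁻¹ * lam = 0 ↔ θ = 0 ∧ B = 0 := by
  have hκ' : 0 < κ⁻¹ := inv_pos.2 hκ
  constructor
  · intro h
    have h1 : 0 ≤ (1 - θ) * B := mul_nonneg (by linarith) hB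
    have h2 : 0 ≤ θ * κ⁻¹ * lam := by positivity
    have hθ : θ = 0 := by nlinarith [mul_pos hκ' hlam]
    refine ⟨hθ, ?_⟩
    rw [hθ] at h; linarith
  · rintro ⟨rfl, rfl⟩; ring

/-! ### §4 The standard face -/

/-- The open **lid zone** `LZ₀ = {ρ² < (1+2s)², -5s/2 < x₂ < 3s/2}` of `CappedBallData.lean`,
on which the side function of a capped sub-ball has the sign of the lid function
(`SubsphereConfig.sign_iff_of_mem_lidZone`). [cite: Schultens2014, proof of Thm. 3.2.5 (PDF p. 45)] -/
def lidZone (s : ℝ) : Set (EuclideanSpace ℝ (Fin 3)) :=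
  {x | hsq x < (1 + 2 * s) ^ 2 ∧ -(5 * s / 2) < x 2 ∧ x 2 < 3 * s / 2}

/-- **Standard face.**  The solid `{F ≤ 0}` has the standard lid of scale `s` (profile `P`) as a
face: on the lid zone, `F` has the sign of the lid function `G = lidFun P s`.
[cite: Schultens2014, proof of Thm. 3.2.5 (PDF p. 45)] -/
def StdFace (F : EuclideanSpace ℝ (Fin 3) → ℝ) (P : ℝ → ℝ) (s : ℝ) : Prop :=
  ∀ x ∈ lidZone s, (F x < 0 ↔ lidFun P s x < 0) ∧ (0 < F x ↔ 0 < lidFun P s x)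

/-- The lid zone is open. [folklore] -/
theorem isOpen_lidZone (s : ℝ) : IsOpen (lidZone s) := by
  have h2 : Continuous fun x : EuclideanSpace ℝ (Fin 3) => x 2 := by fun_prop
  have : lidZone s = {x | hsq x < (1 + 2 * s) ^ 2} ∩ {x | -(5 * s / 2) < x 2} ∩
      {x | x 2 < 3 * s / 2} := by
    ext x; simp [lidZone, and_assoc]
  rw [this]
  exact ((isOpen_lt (contDiff_hsq (n := ∞)).continuous continuous_const).inter
    (isOpen_lt continuous_const h2)).inter (isOpen_lt h2 continuous_const)

/-- The closure of the face box lies in the lid zone (`0 < s`). [folklore] -/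
theorem closure_faceBox_subset_lidZone {s : ℝ} (hs : 0 < s) : closure (faceBox s) ⊆ lidZone s := by
  have h2 : Continuous fun x : EuclideanSpace ℝ (Fin 3) => x 2 := by fun_prop
  have hc : Continuous hsq := (contDiff_hsq (n := ∞)).continuous
  have hcl : IsClosed {x : EuclideanSpace ℝ (Fin 3) | hsq x ≤ (1 + 3 * s / 2) ^ 2 ∧
      -(2 * s) ≤ x 2 ∧ x 2 ≤ 5 * s / 4} := by
    have : {x : EuclideanSpace ℝ (Fin 3) | hsq x ≤ (1 + 3 * s / 2) ^ 2 ∧ -(2 * s) ≤ x 2 ∧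
        x 2 ≤ 5 * s / 4} = {x | hsq x ≤ (1 + 3 * s / 2) ^ 2} ∩ {x | -(2 * s) ≤ x 2} ∩
        {x | x 2 ≤ 5 * s / 4} := by
      ext x; simp [and_assoc]
    rw [this]
    exact ((isClosed_le hc continuous_const).inter (isClosed_le continuous_const h2)).inter
      (isClosed_le h2 continuous_const)
  intro x hx
  have hx' : x ∈ {x : EuclideanSpace ℝ (Fin 3) | hsq x ≤ (1 + 3 * s / 2) ^ 2 ∧ -(2 * s) ≤ x 2 ∧
      x 2 ≤ 5 * s / 4} :=
    closure_minimal (fun y (hy : y ∈ faceBox s) => show y ∈ {x : EuclideanSpace ℝ (Fin 3) |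
        hsq x ≤ (1 + 3 * s / 2) ^ 2 ∧ -(2 * s) ≤ x 2 ∧ x 2 ≤ 5 * s / 4} from
      ⟨hy.1.le, hy.2.1.le, hy.2.2.le⟩) hcl hx
  obtain ⟨h1, h2', h3⟩ := hx'
  refine ⟨lt_of_le_of_lt h1 ?_, by linarith, by linarith⟩
  nlinarith

/-- On the lid zone a standard face has the zero set of the lid function. [folklore] -/
theorem StdFace.eq_zero_iff {F : EuclideanSpace ℝ (Fin 3) → ℝ} {P : ℝ → ℝ} {s : ℝ}
    (h : StdFace F P s) {x : EuclideanSpace ℝ (Fin 3)} (hx : x ∈ lidZone s) :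
    F x = 0 ↔ lidFun P s x = 0 := by
  obtain ⟨h1, h2⟩ := h x hx
  constructor
  · intro h0
    rcases lt_trichotomy (lidFun P s x) 0 with hl | hl | hl
    · have := h1.2 hl; linarith
    · exact hl
    · have := h2.2 hl; linarith
  · intro h0
    rcases lt_trichotomy (F x) 0 with hl | hl | hl
    · have := h1.1 hl; linarith
    · exact hl
    · have := h2.1 hl; linarith

/-- On the lid zone a standard face has the sublevel set of the lid function. [folklore] -/
theorem StdFace.le_iff {F : EuclideanSpace ℝ (Fin 3) → ℝ} {P : ℝ → ℝ} {s : ℝ}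
    (h : StdFace F P s) {x : EuclideanSpace ℝ (Fin 3)} (hx : x ∈ lidZone s) :
    F x ≤ 0 ↔ lidFun P s x ≤ 0 := by
  obtain ⟨-, h2⟩ := h x hx
  constructor
  · intro h0; by_contra hc; exact absurd (h2.2 (not_le.1 hc)) (not_lt.2 h0)
  · intro h0; by_contra hc; exact absurd (h2.1 (not_le.1 hc)) (not_lt.2 h0)

end Literature.Topology.FourManifolds.SweepFace
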